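import Summits.RiemannHypothesis.RiemannHypothesis.Theses.IntegerScrew
import HarnessLib

/-!
# Crux `ScrewPolyFloor` (stmt-RiemannHypothesis-15757) — negative lemma: the index range `2 ≤ m` is load-bearing

The crux `IntegerScrew.ScrewPolyFloor` sums over `Finset.Icc 2 M`.  The same polynomial floor
with the index range started at `m = 1` is FALSE unconditionally: the `m = 1` row and column of
Suzuki's kernel vanish (`G(0,u) = G(t,0) = 0` because `Ψ(0) = 0`; tree
`zetaScrewKernel_zero_left` / `zetaScrewKernel_zero_right`), so the indicator vector of `1` has
screw form `0` and square-sum `1`, while `c · M^{-A} > 0`.  Hence `e₁` is an exact kernel vector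
of every `[G(log m, log m')]_{1 ≤ m,m' ≤ M}` and any proof of the crux must use `2 ≤ m`
(refuter, cdisprove cycle 1; classification: load-bearing hypothesis, not a defect of the crux —
the route aggregates general configurations to `{2, …, M}` precisely through this vanishing,
`floorImpliesScrew_proof`).  Theorems only (no new definitions).
-/

namespace Summit.RiemannHypothesis.Cruxes.ScrewPolyFloor.Negative

open Literature.NumberTheory.LFunctions
open scoped BigOperators

/-- **The index range `2 ≤ m` of `ScrewPolyFloor` is load-bearing**: the crux with
`Finset.Icc 2 M` replaced by `Finset.Icc 1 M` on both sides is false.  Witness `M = 1`,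
`x = 𝟙_{1}`: the left side is `c · 1^{-A} · 1 = c > 0`, the right side is
`G(log 1, log 1) = G(0,0) = 0`. -/
theorem screwPolyFloor_false_from_one :
    ¬ (∃ A c : ℝ, 0 < c ∧ ∀ (M : ℕ) (x : ℕ → ℝ),
        c * (M : ℝ) ^ (-A) * ∑ m ∈ Finset.Icc 1 M, x m ^ 2 ≤
          ∑ m ∈ Finset.Icc 1 M, ∑ m' ∈ Finset.Icc 1 M,
            zetaScrewKernel (Real.log m) (Real.log m') * (x m * x m')) := by
  rintro ⟨A, c, hc, h⟩
  have h1 := h 1 (fun m => if m = 1 then 1 else 0)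
  simp [Real.one_rpow] at h1
  linarith

/-- The same failure at EVERY level `M ≥ 1` and for every candidate pair `(A, c)`, `c > 0`:
the indicator of `1` violates the from-one floor at level `M`, because the whole first row and
column of the kernel matrix vanish. -/
theorem fromOne_floor_fails_at_every_level (A c : ℝ) (hc : 0 < c) (M : ℕ) (hM : 1 ≤ M) :
    ¬ (∀ x : ℕ → ℝ,
      c * (M : ℝ) ^ (-A) * ∑ m ∈ Finset.Icc 1 M, x m ^ 2 ≤
        ∑ m ∈ Finset.Icc 1 M, ∑ m' ∈ Finset.Icc 1 M,
          zetaScrewKernel (Real.log m) (Real.log m') * (x m * x m')) := by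
  intro h
  have hmem : 1 ∈ Finset.Icc 1 M := Finset.mem_Icc.mpr ⟨le_rfl, hM⟩
  have h1 := h (fun m => if m = 1 then 1 else 0)
  have hL : ∑ m ∈ Finset.Icc 1 M, (if m = 1 then (1 : ℝ) else 0) ^ 2 = 1 := by
    rw [Finset.sum_eq_single 1 (fun b _ hb => by simp [hb]) (fun hn => absurd hmem hn)]
    simp
  have hR : ∑ m ∈ Finset.Icc 1 M, ∑ m' ∈ Finset.Icc 1 M,
      zetaScrewKernel (Real.log m) (Real.log m') *
        ((if m = 1 then (1 : ℝ) else 0) * (if m' = 1 then (1 : ℝ) else 0)) = 0 := by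
    apply Finset.sum_eq_zero
    intro m _
    apply Finset.sum_eq_zero
    intro m' _
    by_cases hm : m = 1
    · subst hm; simp
    · simp [hm]
  rw [hL, hR] at h1
  have hpos : 0 < c * (M : ℝ) ^ (-A) * 1 := by
    rw [mul_one]; exact mul_pos hc (Real.rpow_pos_of_pos (by exact_mod_cast hM) _)
  linarith

/-- Equivalently, on the crux's own index set nothing is lost by starting at `2`: the screw form
over `Icc 1 M` of ANY vector equals its screw form over `Icc 2 M` (the `m = 1` row and column
contribute `0`), while the square-sum over `Icc 1 M` exceeds that over `Icc 2 M` by `x_1²` — the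
exact amount by which the from-one floor fails. -/
theorem screwForm_fromOne_eq (M : ℕ) (x : ℕ → ℝ) :
    ∑ m ∈ Finset.Icc 1 M, ∑ m' ∈ Finset.Icc 1 M,
        zetaScrewKernel (Real.log m) (Real.log m') * (x m * x m') =
      ∑ m ∈ Finset.Icc 2 M, ∑ m' ∈ Finset.Icc 2 M,
        zetaScrewKernel (Real.log m) (Real.log m') * (x m * x m') := by
  rcases Nat.lt_or_ge M 1 with hM | hM
  · have h1 : Finset.Icc 1 M = ∅ := Finset.Icc_eq_empty (by omega)
    have h2 : Finset.Icc 2 M = ∅ := Finset.Icc_eq_empty (by omega)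
    simp [h1, h2]
  have hsplit : Finset.Icc 1 M = insert 1 (Finset.Icc 2 M) := by
    ext k
    simp only [Finset.mem_Icc, Finset.mem_insert]
    omega
  have h1notin : (1 : ℕ) ∉ Finset.Icc 2 M := by simp
  rw [hsplit, Finset.sum_insert h1notin]
  simp only [Nat.cast_one, Real.log_one, zetaScrewKernel_zero_left, zero_mul,
    Finset.sum_const_zero, zero_add]
  refine Finset.sum_congr rfl fun m _ => ?_
  rw [Finset.sum_insert h1notin]
  simp

end Summit.RiemannHypothesis.Cruxes.ScrewPolyFloor.Negative
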